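import Mathlib
import HarnessLib
import HarnessLib.Audit
import Summits.SmoothPoincare4.Statement
import HarnessLib.Audit.Status.Attr

/-!
Route: CyclicSymmetryRung

DORMANT since 2026-08-23T16:11:57Z (reconciler: no traction for 6.1 d (last activity item-evidence-added at 2026-08-17T12:55:13Z); parked, not closed — `ledger route dormant route-SmoothPoincare4-CyclicSymmetryRung --off` to reactivate) — unstaffed, not closed; items shared with open routes are served there. `ledger route dormant <id> --off` reactivates.

# Route CyclicSymmetryRung — large cyclic symmetry at bounded extrinsic geometry forces a circle
action; SPC4 via the finite-cyclic rung plus generation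

It suffices to show X = SymInfty ∧ GenInfty: (SymInfty) a closed smooth 4-manifold M ≃ₕ S⁴ that
admits effective smooth
ℤ/p-actions (a diffeomorphism f with f^p = id ≠ f) for infinitely many primes p is diffeomorphic to
S⁴; (GenInfty) every
homotopy 4-sphere admits such actions for infinitely many primes (true for S⁴ ⊂ ℝ⁵ by rotations).
The card
large-cyclic-symmetry-rung is realised by the ENGINE crux SymExt (quantified Fintushel–Pao,
extrinsic form: inside a fixed ℝ^N,
homotopy 4-spheres of reach ≥ τ in the ball B_R with a linear cyclic symmetry of prime order p ≥
p₀(N, τ, R) carry a smooth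
effective circle action) together with the explicit named-fact crux FintushelPao (circle action ⇒
S⁴): these settle SymInfty
in every bounded extrinsic-geometry class (support LargeSymmetryStandard, proved in the sketch). The
superseded card
cyclic-symmetry-lens-hcobordism is realised by the crux OddCyclicRung (ONE symmetry of odd prime
order ⇒ S⁴; pseudofree half =
Chen's lens-space s-cobordism programme, semifree half = cyclic branched covers of 2-knots), which
implies SymInfty (support
RungImpliesSymInfty, proved in the sketch).
Lean: `(∀ (M : Type) [TopologicalSpace M] [T2Space M] [SecondCountableTopology M] [ChartedSpace
(EuclideanSpace ℝ (Fin 4)) M] [IsManifold (𝓡 4) ∞ M], Nonempty (M ≃ₕ Metric.sphere (0 :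
EuclideanSpace ℝ (Fin 5)) 1) → (∀ n : ℕ, ∃ (p : ℕ) (f : M ≃ₘ⟮𝓡 4, 𝓡 4⟯ M), n ≤ p ∧ p.Prime ∧
(⇑f)^[p] = id ∧ ⇑f ≠ id) → Nonempty (M ≃ₘ⟮𝓡 4, 𝓡 4⟯ Metric.sphere (0 : EuclideanSpace ℝ (Fin 5)) 1))
∧ (∀ (M : Type) [TopologicalSpace M] [T2Space M] [SecondCountableTopology M] [ChartedSpace
(EuclideanSpace ℝ (Fin 4)) M] [IsManifold (𝓡 4) ∞ M], Nonempty (M ≃ₕ Metric.sphere (0 :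
EuclideanSpace ℝ (Fin 5)) 1) → ∀ n : ℕ, ∃ (p : ℕ) (f : M ≃ₘ⟮𝓡 4, 𝓡 4⟯ M), n ≤ p ∧ p.Prime ∧ (⇑f)^[p]
= id ∧ ⇑f ≠ id)`

## Assembly
Pure logic (sorry-free in Sketch.lean, 3 lines): `SmoothPoincare4` unfolds to ∀ M (Hausdorff, second
countable, charted on ℝ⁴, C^∞),
M ≃ₕ S⁴ → Nonempty (M ≃ₘ S⁴); given e : M ≃ₕ S⁴, GenInfty supplies symmetries of unboundedly many
prime orders and SymInfty
returns the diffeomorphism. The engine cruxes enter through the supports: LargeSymmetryStandard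
(FintushelPao → SymExt → SymInfty on
every bounded extrinsic-geometry class) and RungImpliesSymInfty (OddCyclicRung → SymInfty); they are
deliberately NOT hypotheses of
the assembly term, so that no hypothesis of the assembly is decorative.

Rationale: WHY THIS LINE. Mechanism (card item 1, sharpened): a sequence of ℤ/p_k-symmetric homotopy 4-spheres
with p_k → ∞ inside one compact geometry
class sub-converges (Blaschke/Federer reach-compactness in ℝ^N, Federer1959) to a limit submanifold
X preserved by the
Hausdorff limit H ⊂ O(N) of the cyclic matrix groups; H is closed and non-discrete (annulus trick),
its effective image on X
is infinite by the C¹ no-small-finite-subgroups averaging lemma, so a circle T ⊂ H acts effectively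
and C^{1,1} on X; Palais1970
conjugates it to a smooth action, Whitney/Hirsch uniqueness transports it to Σ_k ≅_{C¹} X, and
Fintushel1978/Pao1978 (+ Perelman;
Edmonds2009Survey Problem 27) give Σ_k ≅ S⁴ — "a fake 4-sphere cannot be very symmetric without
being very bent"; Dirichlet's
approximation theorem even gives the rate (a prime-order-p cyclic subgroup of SO(N) is
p^{-1/⌊N/2⌋}-dense in a circle subgroup).
Imported areas: compact transformation groups (Palais1970, GroveKarcher1973, MundetRiera2024's
discrete degree of symmetry,
HsiangHsiang1969), geometric measure theory (sets of positive reach, Federer1959), symplectic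
4-orbifold theory for the
pseudofree residual (Chen2004, Chen2006 Thm 1.2 / Conj 1.1, KwasikSchultz1990). What it does that
prior routes do not: no open
route of this summit uses symmetry at all; the catalogued rung 0 (continuous symmetry ⇒ standard,
CircleActionsStandard.lean)
is extended to a quantitative rung (large discrete symmetry at bounded geometry ⇒ standard, provable
modulo the named fact)
and to the finite-cyclic rung with a named 4-dimensional engine; MundetRiera2024 Thm 1.7 (exotic
tori are detected by which
large finite abelian groups act) is the model theorem in another dimension. Negatives index: empty
at filing.

RANKED CRUXES. #2 FintushelPao (crux) — (named fact, made an explicit crux per the plancard rule; =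
Literature.Barriers.SmoothPoincare4.fintushelPao_circleAction_homotopySphere_four verbatim over
Mathlib vocabulary, so it closes by `exact` once that fact is discharged — do NOT re-prove from
scratch) a closed smooth 4-manifold M ≃ₕ S⁴ with a smooth effective action of the circle group is
diffeomorphic to S⁴. [difficulty: XL] (why it might fail: Mathematically settled (Fintushel 1977/78
+ Pao 1978 + Perelman) but printed for locally smooth actions up to equivariant homeomorphism; the
smooth 'diffeomorphic' reading is Edmonds' Problem 27 update; formal delivery is XL (slice theorem,
orbit 3-spaces, Perelman).) [Fintushel1977, Fintushel1978, Pao1978, Edmonds2009Survey]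
#3 SymExt (crux) — (ENGINE, card Claim Q in extrinsic form) for all N, τ > 0, R there is p₀ such
that: if M ≃ₕ S⁴ is a closed smooth 4-manifold, e : M → ℝ^N a smooth embedding with image in the
ball of radius R and reach ≥ τ (unique nearest point within distance τ), and A a linear isometry of
ℝ^N with A(e(M)) = e(M), A^p = id on e(M), A ≠ id on e(M), p prime ≥ p₀, then M admits a smooth
effective circle action (hence M ≅ S⁴ by FintushelPao). Proof plan: reach-compactness (Federer 4.13)
→ limit X and projection C¹-diffeos; Hausdorff limit of ⟨A_k⟩ = closed non-discrete H ⊂ O(N);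
effective image of H on X infinite by C¹ averaging; circle in H; Palais C¹→C^∞; Whitney. [deps:
FintushelPao] [difficulty: L] (why it might fail: The limit circle in O(N) may act on the limit
submanifold with FINITE effective image unless C¹-convergence (reach) transfers near-identity group
elements to C¹-near-trivial actions on Σ_k; Palais 1970 and C¹⇒C^∞ uniqueness are used off the
shelf; p composite is excluded on purpose.) [Federer1959, Palais1970, GroveKarcher1973,
MundetRiera2024, Fintushel1978]
#4 SymInfty (crux) — (on-chain crux) a closed smooth 4-manifold M ≃ₕ S⁴ admitting, for infinitely
many primes p, a diffeomorphism f with f^p = id ≠ f is diffeomorphic to S⁴ ("disc-sym ≥ 1 ⇒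
standard" for homotopy 4-spheres). SymExt + FintushelPao prove it whenever the symmetries are
realised linearly on embeddings in one bounded extrinsic-geometry class (support
LargeSymmetryStandard); OddCyclicRung implies it outright. [deps: SymExt, FintushelPao] [difficulty:
open-problem] (why it might fail: An exotic Σ could carry ℤ/p-symmetries for infinitely many p with
degenerating geometry — cf. exotic tori Tⁿ#Σⁿ (disc-sym = n, tor-sym = 0; MundetRiera2024 §1.4, Thm
1.7) and high-dimensional exotic spheres with circle actions (HsiangHsiang1969); no geometry-free
mechanism is known.) [MundetRiera2024, MundetRieraSaezCalvo2022, HsiangHsiang1969,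
KwasikSchultz1990]
#5 OddCyclicRung (crux) — (finite-cyclic rung, from the superseded card
cyclic-symmetry-lens-hcobordism) a closed smooth 4-manifold M ≃ₕ S⁴ with a diffeomorphism f of odd
prime order p (f^p = id ≠ f) is diffeomorphic to S⁴. By Smith theory Fix(f) is two points
(pseudofree: the quotient of M minus two invariant balls is a smooth h-cobordism W between lens
spaces whose universal cover is M minus two balls; W product ⇒ M twisted sphere ⇒ S⁴ by Cerf;
engine: Chen2006 Thm 1.2, symplectic s-cobordisms of S³/G with canonical contact ends are products)
or a 2-sphere (semifree: M is the p-fold cyclic cover of the homotopy sphere M/f branched along a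
2-knot; engines: Pao–Plotnick for S¹-symmetric branch knots, SymExt for bounded-geometry families).
[difficulty: open-problem] (why it might fail: One exotic Σ with one ℤ/p-symmetry refutes it:
pseudofree case = an exotic s-cobordism of lens spaces with exotic universal cover (Chen 2006
questions (1)(2) open; KwasikSchultz1990 is TOP only); semifree case = an exotic cyclic branched
cover of a 2-knot in a homotopy 4-sphere.) [Chen2006, Chen2004, KwasikSchultz1990,
Edmonds2009Survey, Pao1978]
#6 GenInfty (crux) — (generation, weakest, recorded rather than staffed) every closed smooth
4-manifold M ≃ₕ S⁴ admits, for every n, a diffeomorphism f of prime order p ≥ n (f^p = id ≠ f). True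
for S⁴ (rotations); SPC4 ⇔ SymInfty ∧ GenInfty. [difficulty: open-problem] (why it might fail:
Equivalent to SPC4 given SymInfty and not attackable head-on: no construction of symmetries on an
unknown smooth Σ exists, and exotic structures tend to kill symmetry (exotic tori admit no circle
actions; large-order symmetries of exotic ℝ⁴'s are unknown).) [MundetRiera2024,
MundetRieraSaezCalvo2022, Edmonds1987]
#9 RungImpliesSymInfty (support) — OddCyclicRung → SymInfty (pick one symmetry of prime order ≥ 3
from the infinitely many; proved in the planner's Sketch.lean, 4 lines). [difficulty: provable-now]
[Chen2006]
#9 LargeSymmetryStandard (support) — glue recording the engine's payoff: FintushelPao → SymExt → (a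
closed smooth M ≃ₕ S⁴ which, for infinitely many primes p, embeds in the ball B_R ⊂ ℝ^N with reach ≥
τ invariantly under a linear isometry inducing order p on M, is diffeomorphic to S⁴) — i.e. SymInfty
holds in every bounded extrinsic-geometry class (N, τ, R). Proved in the planner's Sketch.lean (5
lines: take p ≥ p₀(N,τ,R), apply SymExt, then FintushelPao). [difficulty: provable-now]
[Federer1959, Palais1970, Fintushel1978]

TWO-LAYER PLAN. Foreseen glued splits (filed only after a crux closes or in tenure): OddCyclicRung ⇐
PseudofreeStandard → SemifreeStandard →
OddCyclicRung (glue = case split on finiteness of Fix f; PseudofreeStandard further ⇐ ChenBridge [W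
symplectic with canonical contact
lens-space ends ⇒ product, Chen2006 Thm 1.2 as a cite fact] → SymplecticQuotientCobordism [such W
are symplectic; Chen's Problem 1.3 /
Taubes' harmonic-form programme]); SymInfty ⇐ SymInftyBounded (= LargeSymmetryStandard's conclusion)
→ SymInftyUnbounded → SymInfty;
SymExt ⇐ ReachCompactnessLimitGroup (analytic half: limit X, closed non-discrete H ⊂ O(N) with
infinite effective image) →
CircleSmoothing (Palais + Whitney: C^{1,1} effective circle action on X ⇒ smooth effective circle
action on M) → SymExt. The
intrinsic Claim Q of the card (|Rm| ≤ Λ, vol ≥ v, diam ≤ D, isometric ℤ/p) ⇐ SymExt + an equivariant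
Cheeger–Gromov/harmonic
embedding lemma; not filed at open (needs `riemVolume` measurable-structure plumbing; the extrinsic
form is the primitive statement).

KILL CRITERIA. OddCyclicRung refuted (an exotic homotopy 4-sphere with one odd-prime symmetry) or
SymInfty refuted ⇒ ¬SmoothPoincare4 outright —
the route closes together with every positive route (close --reason refuted:<Decl>, hand the witness
to ZeroSurgeryExotic /
GluckLasagna). SymExt refuted (a bounded-reach family Σ_k ⊂ ℝ^N with linear ℤ/p_k-symmetry, p_k → ∞,
and no circle action) kills
the CARD's mechanism but not the rung: pivot to OddCyclicRung-only (finite-cyclic rung, Chen engine)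
and re-rank. GenInfty refuted
(a homotopy 4-sphere with only finitely many prime symmetry orders) does not refute SPC4 formally
but, by SymInfty∧GenInfty ⇔ SPC4,
exhibits an exotic sphere — same closure. FintushelPao cannot be refuted (theorem); if its
Literature fact is re-triaged xl-apex
the route stays conditional on it, stated. SmoothPoincare4 proved elsewhere moots everything;
OddCyclicRung proved elsewhere
(e.g. via Chen's Conj 1.1 + a branched-cover theorem) promotes SymInfty to proved via
RungImpliesSymInfty.

NOT DECOMPOSED YET. The pseudofree/semifree halves of OddCyclicRung and the Chen bridge (need lens
spaces L(p;a,b), 4-dimensional cobordisms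
between closed 3-manifolds and 'symplectic cobordism with contact-type ends' as Literature notions —
definition requests
deferred to the first split); the p = 2 strata (free involutions = fake ℝℙ⁴ quotients with STANDARD
cover, reflections =
card doubles-reflection-rung, semifree involutions) — excluded by 'odd'; the analytic sub-lemmas of
SymExt (reach-compactness
with C¹ control, Hausdorff limits of finite subgroups of O(N), the C¹ averaging lemma, Palais,
Whitney) — internal lemmas of
its prover, not items; the equivariant sharpening EXT (for p ≥ p₀ the ℤ/p-action itself extends,
after C¹-small conjugation,
to a circle action; Grove–Karcher) and its corollary 'the only 2-knots whose cyclic branched covers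
have uniformly bounded
geometry are the S¹-symmetric (twist-spun-type) ones' — a rigidity statement for 2-knots, recorded
for a later crux; the
intrinsic Claim Q (above); any use of Newman's theorem (not needed once convergence is C¹).

CHEAPEST FALSIFIER. Lookups first: (i) is 'a homotopy 4-sphere with ℤ/p-actions for infinitely many
p is S⁴' or 'large finite cyclic symmetry
⇒ circle action' already in print for (homology) 4-spheres in the disc-sym / Jordan literature
(MundetRiera2024,
MundetRieraSaezCalvo2022, their refs [CKS] Chen–Kwasik–Schultz, [MZ2] Mecchia–Zimmermann)? Searched
this session (zbMATH +
full text of both papers): torus (Thm 1.7) and Kaehler (Thm 1.9) cases are in print, the 4-sphere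
case is not — a positive
find makes SymExt/SymInfty 'known'. (ii) Does KwasikSchultz1990 or Chen2004/2006 already give SMOOTH
triviality of lens-space
h-cobordisms whose 1-connected cover is a product? Chen2006 pp.1–2 read: open ('not much is known in
the smooth category').
(iii) Sanity family: Pao's non-linear circle actions on S⁴ restricted to ℤ/p ⊂ S¹ (p coprime to the
exceptional isotropy
orders) are non-linear pseudofree ℤ/p-actions on the TRUE S⁴ in one geometry class for all p —
consistent with SymExt; a
refuter should check that no step of the SymExt sketch secretly uses linearity of the action on Σ.

NUMBERS. disc-sym(X) ≤ 3n/2 = 6 for closed connected 4-manifolds (MundetRiera2024 Thm 1.2; Mann–Su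
finiteness); tor-sym(S⁴) = 2,
disc-sym(S⁴) ≥ 2. Rate heuristic for SymExt: a cyclic subgroup of SO(N) of prime order p lies in a
circle subgroup in which
it is C·p^(−1/⌊N/2⌋)-dense (Dirichlet), so a ℤ/p-invariant Σ ⊂ B_R is
O(R·p^(−1/⌊N/2⌋))-Hausdorff-close to its images under
a whole circle of isometries; expected threshold p₀(N, τ, R) ≲ (C·R/τ)^⌊N/2⌋ (conjectural,
ineffective in the compactness
proof). Chen2006: TOP s-cobordisms of each elliptic 3-manifold form a finite set (Cappell–Shaneson,
Kwasik–Schultz); smooth: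
open questions (1)(2) of Chen2006 p.2. Items at open: 8 (5 cruxes, 2 supports, 1 assembly).

DEFINITION REQUESTS. None for the filed items (all over Mathlib: Circle, ContMDiffSMul,
FaithfulSMul, Diffeomorph, LinearIsometryEquiv,
Metric.infDist, Manifold.IsSmoothEmbedding, Function.iterate; plus the summit constant). Deferred to
the first split of
OddCyclicRung: `LensSpace p q` (quotient of S³ ⊂ ℂ² by (z,w) ↦ (ζz, ζ^q w)), `IsCobordismBetween W
Y₁ Y₂` for compact
4-manifolds with two closed 3-manifold boundary components, `IsSymplecticCobordismOfContactType`
(Chen2006 §1 definition: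
Liouville vector field near ∂W inducing ξ_i), and the cite fact Chen2006 Thm 1.2. No cite item is
filed now (D-0026: keep
Literature debt inside the staffed cone).

Novelty: Searches (2026-08-15): `lit search --source zbmath "Mundet i Riera discrete degree of symmetry"` (2:
arXiv:2112.05599,
arXiv:2507.22525) + `lit read arxiv:2112.05599` (pp.1–6, 28–29: Thm 1.2, 1.7, 1.11, §1.4); `lit
search --source zbmath
"Mundet i Riera Saez-Calvo which finite groups act smoothly on a given 4-manifold"` (1:
doi:10.1090/tran/8518) + `lit read
arxiv:1901.04223` pp.1–8 (Thm 1.1–1.5; S⁴'s finite symmetry groups [CKS, MZ2]); `lit read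
arxiv:math/0403396` pp.1–4
(Chen Conj 1.1, Thm 1.2, Problem 1.3, questions (1)(2)); `lit search --source crossref` for Edmonds
1987 / Hsiang–Hsiang
1969 / Schultz 1971 (degree of symmetry of homotopy spheres); `lit frontier SmoothPoincare4 --since
2021` (21 rows: nothing
on finite group actions on homotopy 4-spheres); `lit bridges SmoothPoincare4 --cross any` (noise);
`lit galaxy search
"pseudofree actions on homotopy 4-spheres" --star all` and `"group actions on homotopy spheres"
--star all` (0 rows; pdf/panama
queues timed out — service degraded this session, recorded); `lit search --source arxiv`
rate-limited (429); `ledger negatives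
--problem SmoothPoincare4` (0); `ledger idea list` (129 cards: symmetry cards
quotient-spheres-orbifold, doubles-reflection-rung,
local-symmetry-ladder-fstructures, branch-surface-unknotting, cyclic-symmetry-lens-hcobordism read);
the 9 route files of the
sub (none uses symmetry); barrier files CircleActionsStandard(.lean, Proofs), ExoticFreeInvolutions.
Nearest prior art found: Fintushel1978/Pao1978  [refs: 10.1090/tran/8518, 2112.05599, 2507.22525, 1901.04223, math/0403396, arxiv:2112.05599, doi:10.1090/tran/8518, arxiv:1901.04223, arxiv:math/0403396, Fintushel1978, Pao1978, MundetRiera2024, Edmonds1987, MundetRieraSaezCalvo2022, HsiangHsiang1969, Chen2006, Chen2004, KwasikSchultz1990, Palais1970, GroveKarcher1973, Federer1959]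

Barriers (technique_class: discrete-symmetry; equivariant-compactness; lens-s-cobordism): - technique_class: discrete-symmetry; equivariant-compactness; lens-s-cobordism
- Literature.Barriers.SmoothPoincare4.CircleActionBarrierFour: EXTENDED, not evaded — the named fact
behind it (fintushelPao_circleAction_homotopySphere_four) is crux FintushelPao and the last step of
the engine; nothing exotic is built with symmetry; the barrier's own 'evasions_known' line (finite
groups not covered) is exactly the gap this route works in.
- Literature.Barriers.SmoothPoincare4.ProjectiveRigidityBarrierFour: engaged and respected — free
involutions (fake ℝℙ⁴) act on the STANDARD S⁴ and are excluded twice (p odd; conclusions are always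
'M ≅ S⁴', never 'the action is linear'); Pao's non-linear circle actions restricted to ℤ/p show
non-linear pseudofree actions on the true S⁴ exist, consistent with every item.
- Literature.Barriers.SmoothPoincare4.TwistedSphereBarrierFour: used positively inside the
pseudofree half of OddCyclicRung (W product ⇒ cover S³×I ⇒ twisted sphere ⇒ S⁴ via
cerf_twistedSphere_four), not as a construction of exotica.
- Literature.Barriers.SmoothPoincare4.HCobordismBarrierFour: not invoked — no 'h-cobordant ⇒
diffeomorphic' principle for 4-manifolds is assumed; on the contrary the possible failure of the
4-dimensional s-cobordism theorem for lens spaces is NAMED as the residual (Chen2006 questions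
(1)(2)), with Cappell–Shaneson/Akbulut (S³/Q₈, cover standard) as the recorded precedent.
- Literature.Barriers.SmoothPoincare4.CappellShanesonFamilyBarrier: CS sphere

Novelty grade: new-combination — refuter route-review grade. Nearest prior art: (a) Fintushel1978/Pao1978 (+Perelman; Edmonds Pb 27) = rung 0, tree CircleActionsStandard; (b) Mundet i Riera arXiv:2112.05599 (disc-sym vs tor-sym; Thm 1.7 exotic tori detected by large finite abelian actions = model theorem in another dimension), Mund (refuter refuter-rreview-route-MatrixMultiplicati-95e7b4aa-0, 2026-08-15T14:13:34Z; prior: Fintushel1978, Pao1978, arxiv:2112.05599, arxiv:1901.04223, arxiv:math/0403396, GroveKarcher1973, Palais1970, doi:10.1007/s002080050243, HsiangHsiang1969, Edmonds2009Survey)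

History (route lifecycle, newest last):
- 2026-08-23T16:11:57Z · DORMANT — reconciler: no traction for 6.1 d (last activity item-evidence-added at 2026-08-17T12:55:13Z); parked, not closed — `ledger route dormant route-SmoothPoincare4- (operator:999:1251105)

sub-problem: SmoothPoincare4 · status: dormant · opened planner-plancard-SmoothPoincare4-SmoothPoinca-97a0711b-0 2026-08-15T11:43:43Z · rev 1 · ledger route-SmoothPoincare4-CyclicSymmetryRung
GENERATED by the gate from the ledger (D-0016/17). Provers cite these decls: `theorem foo : Summit.SmoothPoincare4.SmoothPoincare4.Theses.CyclicSymmetryRung.<Decl> := …` in Summits/SmoothPoincare4/SmoothPoincare4/Theorems/<Name>.lean.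
-/

namespace Summit.SmoothPoincare4.SmoothPoincare4.Theses.CyclicSymmetryRung

open scoped BigOperators Topology Manifold Classical MeasureTheory ProbabilityTheory Matrix InnerProductSpace ComplexConjugate ContinuousMap ContDiff
open Filter Set Function TopologicalSpace MeasureTheory

attribute [summit_statement] _root_.SmoothPoincare4

open Literature.SPC4

/-- item stmt-SmoothPoincare4-5977 · crux · rank 2 · open · by planner
why it might fail: Mathematically settled (Fintushel 1977/78 + Pao 1978 + Perelman) but printed for locally smooth actions up to equivariant homeomorphism; the smooth 'diffeomorphic' reading is Edmonds' Problem 27 update; formal delivery is XL (slice theorem, orbit 3-spaces, Perelman).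
sources: Fintushel1977, Fintushel1978, Pao1978, Edmonds2009Survey
[crux] (named fact, made an explicit crux per the plancard rule; =
Literature.Barriers.SmoothPoincare4.fintushelPao_circleAction_homotopySphere_four verbatim over
Mathlib vocabulary, so it closes by `exact` once that fact is discharged — do NOT re-prove from
scratch) a closed smooth 4-manifold M ≃ₕ S⁴ with a smooth effective action of the circle group is
diffeomorphic to S⁴. [difficulty: XL] -/
@[route_item "route-SmoothPoincare4-CyclicSymmetryRung"]
def FintushelPao : Prop :=
  ∀ (M : Type) [TopologicalSpace M] [T2Space M] [SecondCountableTopology M] [ChartedSpace (EuclideanSpace ℝ (Fin 4)) M] [IsManifold (𝓡 4) ∞ M] [CompactSpace M] [MulAction Circle M], FaithfulSMul Circle M → ContMDiffSMul (𝓡 1) (𝓡 4) ∞ Circle M → Nonempty (M ≃ₕ Metric.sphere (0 : EuclideanSpace ℝ (Fin 5)) 1) → Nonempty (M ≃ₘ⟮𝓡 4, 𝓡 4⟯ Metric.sphere (0 : EuclideanSpace ℝ (Fin 5)) 1)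

/-- item stmt-SmoothPoincare4-5978 · crux · rank 3 · open · by planner
why it might fail: The limit circle in O(N) may act on the limit submanifold with FINITE effective image unless C¹-convergence (reach) transfers near-identity group elements to C¹-near-trivial actions on Σ_k; Palais 1970 and C¹⇒C^∞ uniqueness are used off the shelf; p composite is excluded on purpose.
sources: Federer1959, Palais1970, GroveKarcher1973, MundetRiera2024, Fintushel1978
[crux] (ENGINE, card Claim Q in extrinsic form) for all N, τ > 0, R there is p₀ such that: if M ≃ₕ
S⁴ is a closed smooth 4-manifold, e : M → ℝ^N a smooth embedding with image in the ball of radius R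
and reach ≥ τ (unique nearest point within distance τ), and A a linear isometry of ℝ^N with A(e(M))
= e(M), A^p = id on e(M), A ≠ id on e(M), p prime ≥ p₀, then M admits a smooth effective circle
action (hence M ≅ S⁴ by FintushelPao). Proof plan: reach-compactness (Federer 4.13) → limit X and
projection C¹-diffeos; Hausdorff limit of ⟨A_k⟩ = closed non-discrete H ⊂ O(N); effective image of H
on X infinite by C¹ averaging; circle in H; Palais C¹→C^∞; Whitney. [deps: FintushelPao]
[difficulty: L] -/
@[route_item "route-SmoothPoincare4-CyclicSymmetryRung"]
def SymExt : Prop :=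
  ∀ (N : ℕ) (τ R : ℝ), 0 < τ → ∃ p₀ : ℕ, ∀ (M : Type) [TopologicalSpace M] [T2Space M] [SecondCountableTopology M] [ChartedSpace (EuclideanSpace ℝ (Fin 4)) M] [IsManifold (𝓡 4) ∞ M] [CompactSpace M] (e : M → EuclideanSpace ℝ (Fin N)) (A : EuclideanSpace ℝ (Fin N) ≃ₗᵢ[ℝ] EuclideanSpace ℝ (Fin N)) (p : ℕ), Nonempty (M ≃ₕ Metric.sphere (0 : EuclideanSpace ℝ (Fin 5)) 1) → p.Prime → p₀ ≤ p → Manifold.IsSmoothEmbedding (𝓡 4) 𝓘(ℝ, EuclideanSpace ℝ (Fin N)) ∞ e → (∀ x, ‖e x‖ ≤ R) → (∀ y : EuclideanSpace ℝ (Fin N), Metric.infDist y (Set.range e) < τ → ∃! z, z ∈ Set.range e ∧ dist y z = Metric.infDist y (Set.range e)) → ⇑A '' Set.range e = Set.range e → (∀ x, (⇑A)^[p] (e x) = e x) → (∃ x, A (e x) ≠ e x) → ∃ _ : MulAction Circle M, FaithfulSMul Circle M ∧ ContMDiffSMul (𝓡 1) (𝓡 4) ∞ Circle M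

/-- item stmt-SmoothPoincare4-5979 · crux · rank 4 · open · by planner
why it might fail: An exotic Σ could carry ℤ/p-symmetries for infinitely many p with degenerating geometry — cf. exotic tori Tⁿ#Σⁿ (disc-sym = n, tor-sym = 0; MundetRiera2024 §1.4, Thm 1.7) and high-dimensional exotic spheres with circle actions (HsiangHsiang1969); no geometry-free mechanism is known.
sources: MundetRiera2024, MundetRieraSaezCalvo2022, HsiangHsiang1969, KwasikSchultz1990
[crux] (on-chain crux) a closed smooth 4-manifold M ≃ₕ S⁴ admitting, for infinitely many primes p, a
diffeomorphism f with f^p = id ≠ f is diffeomorphic to S⁴ ("disc-sym ≥ 1 ⇒ standard" for homotopy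
4-spheres). SymExt + FintushelPao prove it whenever the symmetries are realised linearly on
embeddings in one bounded extrinsic-geometry class (support LargeSymmetryStandard); OddCyclicRung
implies it outright. [deps: SymExt, FintushelPao] [difficulty: open-problem] -/
@[route_item "route-SmoothPoincare4-CyclicSymmetryRung", crux]
def SymInfty : Prop :=
  ∀ (M : Type) [TopologicalSpace M] [T2Space M] [SecondCountableTopology M] [ChartedSpace (EuclideanSpace ℝ (Fin 4)) M] [IsManifold (𝓡 4) ∞ M], Nonempty (M ≃ₕ Metric.sphere (0 : EuclideanSpace ℝ (Fin 5)) 1) → (∀ n : ℕ, ∃ (p : ℕ) (f : M ≃ₘ⟮𝓡 4, 𝓡 4⟯ M), n ≤ p ∧ p.Prime ∧ (⇑f)^[p] = id ∧ ⇑f ≠ id) → Nonempty (M ≃ₘ⟮𝓡 4, 𝓡 4⟯ Metric.sphere (0 : EuclideanSpace ℝ (Fin 5)) 1)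

/-- item stmt-SmoothPoincare4-5980 · crux · rank 5 · open · by planner
why it might fail: One exotic Σ with one ℤ/p-symmetry refutes it: pseudofree case = an exotic s-cobordism of lens spaces with exotic universal cover (Chen 2006 questions (1)(2) open; KwasikSchultz1990 is TOP only); semifree case = an exotic cyclic branched cover of a 2-knot in a homotopy 4-sphere.
sources: Chen2006, Chen2004, KwasikSchultz1990, Edmonds2009Survey, Pao1978
[crux] (finite-cyclic rung, from the superseded card cyclic-symmetry-lens-hcobordism) a closed
smooth 4-manifold M ≃ₕ S⁴ with a diffeomorphism f of odd prime order p (f^p = id ≠ f) is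
diffeomorphic to S⁴. By Smith theory Fix(f) is two points (pseudofree: the quotient of M minus two
invariant balls is a smooth h-cobordism W between lens spaces whose universal cover is M minus two
balls; W product ⇒ M twisted sphere ⇒ S⁴ by Cerf; engine: Chen2006 Thm 1.2, symplectic s-cobordisms
of S³/G with canonical contact ends are products) or a 2-sphere (semifree: M is the p-fold cyclic
cover of the homotopy sphere M/f branched along a 2-knot; engines: Pao–Plotnick for S¹-symmetric
branch knots, SymExt for bounded-geometry families). [difficulty: open-problem] -/
@[route_item "route-SmoothPoincare4-CyclicSymmetryRung"]
def OddCyclicRung : Prop :=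
  ∀ (M : Type) [TopologicalSpace M] [T2Space M] [SecondCountableTopology M] [ChartedSpace (EuclideanSpace ℝ (Fin 4)) M] [IsManifold (𝓡 4) ∞ M] (p : ℕ) (f : M ≃ₘ⟮𝓡 4, 𝓡 4⟯ M), Nonempty (M ≃ₕ Metric.sphere (0 : EuclideanSpace ℝ (Fin 5)) 1) → p.Prime → Odd p → (⇑f)^[p] = id → ⇑f ≠ id → Nonempty (M ≃ₘ⟮𝓡 4, 𝓡 4⟯ Metric.sphere (0 : EuclideanSpace ℝ (Fin 5)) 1)

/-- item stmt-SmoothPoincare4-5981 · crux · rank 6 · open · by planner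
why it might fail: Equivalent to SPC4 given SymInfty and not attackable head-on: no construction of symmetries on an unknown smooth Σ exists, and exotic structures tend to kill symmetry (exotic tori admit no circle actions; large-order symmetries of exotic ℝ⁴'s are unknown).
sources: MundetRiera2024, MundetRieraSaezCalvo2022, Edmonds1987
[crux] (generation, weakest, recorded rather than staffed) every closed smooth 4-manifold M ≃ₕ S⁴
admits, for every n, a diffeomorphism f of prime order p ≥ n (f^p = id ≠ f). True for S⁴
(rotations); SPC4 ⇔ SymInfty ∧ GenInfty. [difficulty: open-problem] -/
@[route_item "route-SmoothPoincare4-CyclicSymmetryRung", crux]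
def GenInfty : Prop :=
  ∀ (M : Type) [TopologicalSpace M] [T2Space M] [SecondCountableTopology M] [ChartedSpace (EuclideanSpace ℝ (Fin 4)) M] [IsManifold (𝓡 4) ∞ M], Nonempty (M ≃ₕ Metric.sphere (0 : EuclideanSpace ℝ (Fin 5)) 1) → ∀ n : ℕ, ∃ (p : ℕ) (f : M ≃ₘ⟮𝓡 4, 𝓡 4⟯ M), n ≤ p ∧ p.Prime ∧ (⇑f)^[p] = id ∧ ⇑f ≠ id

/-- item stmt-SmoothPoincare4-5982 · support · rank 9 · open · by planner
sources: Chen2006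
[support] OddCyclicRung → SymInfty (pick one symmetry of prime order ≥ 3 from the infinitely many;
proved in the planner's Sketch.lean, 4 lines). [difficulty: provable-now] -/
@[route_item "route-SmoothPoincare4-CyclicSymmetryRung"]
def RungImpliesSymInfty : Prop :=
  OddCyclicRung → SymInfty

/-- item stmt-SmoothPoincare4-5983 · support · rank 9 · open · by planner
sources: Federer1959, Palais1970, Fintushel1978
[support] glue recording the engine's payoff: FintushelPao → SymExt → (a closed smooth M ≃ₕ S⁴
which, for infinitely many primes p, embeds in the ball B_R ⊂ ℝ^N with reach ≥ τ invariantly under a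
linear isometry inducing order p on M, is diffeomorphic to S⁴) — i.e. SymInfty holds in every
bounded extrinsic-geometry class (N, τ, R). Proved in the planner's Sketch.lean (5 lines: take p ≥
p₀(N,τ,R), apply SymExt, then FintushelPao). [difficulty: provable-now] -/
@[route_item "route-SmoothPoincare4-CyclicSymmetryRung"]
def LargeSymmetryStandard : Prop :=
  FintushelPao → SymExt → ∀ (M : Type) [TopologicalSpace M] [T2Space M] [SecondCountableTopology M] [ChartedSpace (EuclideanSpace ℝ (Fin 4)) M] [IsManifold (𝓡 4) ∞ M] [CompactSpace M] (N : ℕ) (τ R : ℝ), 0 < τ → Nonempty (M ≃ₕ Metric.sphere (0 : EuclideanSpace ℝ (Fin 5)) 1) → (∀ n : ℕ, ∃ (p : ℕ) (e : M → EuclideanSpace ℝ (Fin N)) (A : EuclideanSpace ℝ (Fin N) ≃ₗᵢ[ℝ] EuclideanSpace ℝ (Fin N)), n ≤ p ∧ p.Prime ∧ Manifold.IsSmoothEmbedding (𝓡 4) 𝓘(ℝ, EuclideanSpace ℝ (Fin N)) ∞ e ∧ (∀ x, ‖e x‖ ≤ R) ∧ (∀ y : EuclideanSpace ℝ (Fin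 N), Metric.infDist y (Set.range e) < τ → ∃! z, z ∈ Set.range e ∧ dist y z = Metric.infDist y (Set.range e)) ∧ ⇑A '' Set.range e = Set.range e ∧ (∀ x, (⇑A)^[p] (e x) = e x) ∧ (∃ x, A (e x) ≠ e x)) → Nonempty (M ≃ₘ⟮𝓡 4, 𝓡 4⟯ Metric.sphere (0 : EuclideanSpace ℝ (Fin 5)) 1)

/-- item stmt-SmoothPoincare4-5984 · assembly · rank 1 · open · by planner
sources: Kirby1997, Fintushel1978
[assembly] SymInfty → GenInfty → SmoothPoincare4. -/
@[route_item "route-SmoothPoincare4-CyclicSymmetryRung"]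
def Assembly : Prop :=
  SymInfty → GenInfty → SmoothPoincare4

/-! D-0027 §2.1 — DECIDING THEOREM (planner-authored via `route open/edit --closes-file`; by planner-rbadge-SmoothPoincare4-CyclicSymmetryR-36c58975-g4-0 2026-08-15T16:10:54Z):
its hypotheses are this route's items and its conclusion the sub-problem Statement (glue_lint), and it elaborates with this file. -/

/-- D-0027 §2.1 deciding theorem of route CyclicSymmetryRung: the thesis X = SymInfty ∧ GenInfty
decides `SmoothPoincare4` by pure logic. `SmoothPoincare4` unfolds to: for every Hausdorff
second-countable `M : Type`, every `C^∞` atlas on `M` modelled on `ℝ⁴` and every homotopy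
equivalence `e : M ≃ₕ S⁴`, `Nonempty (M ≃ₘ⟮𝓡 4, 𝓡 4⟯ S⁴)`. Given `e`, GenInfty supplies
self-diffeomorphisms of unboundedly many prime orders and SymInfty returns the diffeomorphism.
The engine items (FintushelPao, SymExt, OddCyclicRung and the supports LargeSymmetryStandard,
RungImpliesSymInfty) feed SymInfty and are deliberately not hypotheses here, so that no
hypothesis of the deciding theorem is decorative. -/
@[closes "route-SmoothPoincare4-CyclicSymmetryRung"] theorem closes (hS : SymInfty) (hG : GenInfty) : _root_.SmoothPoincare4 := by
  unfold _root_.SmoothPoincare4 Literature.SPC4.SmoothPoincareConjectureFour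
    ContinuousMap.HomotopyEquiv.NonemptyDiffeomorphSphere
  intro M _ _ _ _ _ e
  exact hS M ⟨e⟩ (hG M ⟨e⟩)

end Summit.SmoothPoincare4.SmoothPoincare4.Theses.CyclicSymmetryRung
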